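import Summits.ResolutionOfSingularities.ResolutionOfSingularities.Theorems.TightCutLawJ2
import HarnessLib

/-!
# TightCutWitness — decomp-res node «TightCut» (lens-3 g17), tree file 2/7: §J₂.4 the cubic face of `F_{t+1}`
and the two witnesses (the cubic
witness `u^{r_{t+1}} u_k^3` by the power law, the QUARTIC WITNESS `u^{r_{t+1}} u_i^4 u_j` by the axis law), §J₂.5
their transport to `F_{t+2}`.
PROVED, 0 sorry.

Content VERBATIM from the decomp-res lens-3 g17 file `HOME/decomp-res-lens-3/g17/TightCut.lean` (sha256
7fe2fb69bd2eaf82, 3149 l;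
HOME = run/shared/lean/pub/decomp-res).  Critic: CRITIC-LEDGER row 136 CLEARED, landing order 2026-08-30T19:49:35Z
(after node «ShadeCut» =
`Theorems/ShadeCutLawJ`, `ShadeCutTailTwo`, `ShadeCutShadeTwo`, `MaxContactCutShadeCut`).

[WRITER NOTE (decomp-res writer g7): the lens's carried VERBATIM copies §V1/§V2 (g15 ConeCut calculus),
§J/§S/§K/§L/§M (g16 ShadeCut) are
DELETED in favour of the landed `Theorems/ConeCut*`, `ConeCutAxisLaw`, `FloorCutFloor`, `ShadeCut*`,
`MaxContactCutShadeCut` (imported and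
opened; `exists_third`/`exists_ne` now the tree's `ConeCut.exists_third` / `FloorCut.exists_ne`); the by-name
`closes` re-export (§M) is not
restated; g16's `fin3_enum` (dedup of a Literature triviality) becomes a proof-local `have … := by decide` in `prod_three`.  NEW content only, split by the lens's own sections (400-line file limit): `TightCutLawJ2` (§J₂.1–§J₂.3), `TightCutWitness`
(§J₂.4–§J₂.5), `TightCutCharts` + `TightCutCharts2` (§J₂.6), `TightCutPoverty` (§P), `TightCutClasses`
(cone-free: the two §K3 classes, home of
the aside), `MaxContactCutTightCut` (Theses cone: §K3 theorems + §L4 + §N).  ONE namespace `…Theorems.TightCut`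
as in the lens; global
`set_option` line dropped; nothing else changed.]
(Sources: CossartPiltant2008 Prop. 4.2; CossartPiltant2009; CossartJannsenSaito2020; Hauser2010; Moh1987;
HauserPerlega2019; BenitoVillamayor2012; Cutkosky2009 Thm. 5.1.)
-/

noncomputable section

open MvPolynomial Finset
open Literature.AlgebraicGeometry.Resolution
open Literature.AlgebraicGeometry.Resolution.Hauser2010
open Literature.AlgebraicGeometry.Resolution.PointBlowup
open Summit.ResolutionOfSingularities.ResolutionOfSingularities.Theses
open Summit.ResolutionOfSingularities.ResolutionOfSingularities.Theorems.TightDefectClasses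
open Summit.ResolutionOfSingularities.ResolutionOfSingularities.Theorems.TightDefectStrongWalks
open Summit.ResolutionOfSingularities.ResolutionOfSingularities.Theorems.ItineraryCutClasses
open Summit.ResolutionOfSingularities.ResolutionOfSingularities.Theorems.BoundaryLedger
open Summit.ResolutionOfSingularities.ResolutionOfSingularities.Theorems.ProximityCut
open Summit.ResolutionOfSingularities.ResolutionOfSingularities.Theorems.ConeCutAxisLaw
open Literature.AlgebraicGeometry.Resolution.WeightedBlowup
open Literature.Barriers.ResolutionOfSingularities
open Summit.ResolutionOfSingularities.ResolutionOfSingularities.Theorems.FloorCut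
open Summit.ResolutionOfSingularities.ResolutionOfSingularities.Theorems.ConeCut
open Summit.ResolutionOfSingularities.ResolutionOfSingularities.Theorems.ExitLaw (fin3_cases)
open Summit.ResolutionOfSingularities.ResolutionOfSingularities.Theorems.ShadeCut

namespace Summit.ResolutionOfSingularities.ResolutionOfSingularities.Theorems.TightCut

section LawJ2Witness

variable {K : Type} [Field K] [DecidableEq K] {q : ℕ} {s₀ : State (Fin 3) K}

omit [DecidableEq K] in
/-- A monomial of `F` has degree at least the order. [folklore] -/
theorem le_degree_of_coeff_ne_zero {F : MvPolynomial (Fin 3) K} {o : ℕ} (ho : ordZero F = o) {M : Fin 3 →₀ ℕ}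
    (h : coeff M F ≠ 0) : o ≤ M.degree := by
  by_contra hlt
  push Not at hlt
  exact h (coeff_eq_zero_of_degree_lt_ordZero (by rw [ho]; exact_mod_cast hlt))

/-- An exponent with a coordinate strictly between `0` and `q` is not a `q`-th power exponent. [folklore] -/
theorem not_isPthPowerExponent_of_coord {M : Fin 3 →₀ ℕ} (l : Fin 3) (h0 : 0 < M l) (hq : M l < q) :
    ¬ IsPthPowerExponent q M := fun hP => by
  have h := Nat.le_of_dvd h0 ((isPthPowerExponent_iff q M).mp hP l)
  omega

/-- An exponent below a pure power of `u_i` is a pure power of `u_i`. [folklore] -/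
theorem eq_single_of_le_single {i : Fin 3} {a : ℕ} {y : Fin 3 →₀ ℕ} (h : y ≤ Finsupp.single i a) :
    y = Finsupp.single i (y i) := by
  ext l
  by_cases hl : l = i
  · rw [hl, Finsupp.single_eq_same]
  · have h1 := Finsupp.le_def.mp h l
    rw [Finsupp.single_eq_of_ne hl] at h1
    rw [Finsupp.single_eq_of_ne hl]
    omega

namespace TightRepeat

variable {W : ForcedWalk q s₀} {t : ℕ} {k : Fin 3}

/-! ### §J₂.4 The cubic face of `F_{t+1}` and the two witnesses -/

/-- **THE CUBIC FACE OF `F_{t+1}` (PROVED).**  By the power law (`β = 0`: `N_t = c·u_k³`) and the face identity, for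
`μ` off `u_{j_t}`: `coeff_{r_{t+1} + μ} F_{t+1} = coeff_{μ − 3e_k} U_t · c` (zero unless `μ ≥ 3e_k`). [new]
[folklore] -/
theorem coeff_face (hroot : IsRoot q s₀) (h : TightRepeat W t k) {o₀ o₁ : ℕ} (ho₀ : ordZero (W.st t).F = o₀)
    (ho₁ : ordZero (W.st (t + 1)).F = o₁) :
    ∃ c : K, c ≠ 0 ∧ ∀ μ : Fin 3 →₀ ℕ, μ (W.j t) = 0 →
      coeff ((W.st (t + 1)).r + μ) (W.st (t + 1)).F =
        if Finsupp.single k 3 ≤ μ then coeff (μ - Finsupp.single k 3) (bPoly W t) * c else 0 := by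
  classical
  obtain ⟨p₀, p₁, p₂, hp₀, hp₁, -, hq0, hq0', hq1, -, -, -, -, -, -⟩ := h.orders hroot
  have e0 : p₀ = o₀ := by have := hp₀.symm.trans ho₀; exact_mod_cast this
  have e1 : p₁ = o₁ := by have := hp₁.symm.trans ho₁; exact_mod_cast this
  subst e0 e1
  obtain ⟨c, hc, hpow⟩ :=
    resForm_eq_pow_of_repeat hroot W t ho₀ ho₁ hq0 hq1 h.plat₀ h.plat₁ h.three h.stays h.ki h.kj
  rw [h.bk, map_zero, zero_mul, sub_zero] at hpow
  refine ⟨c, hc, fun μ hμj => ?_⟩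
  have hr : (W.st (t + 1)).r + μ = kept W t + μ + Finsupp.single (W.j t) (p₀ - q) := by
    rw [r_succ_eq W t ho₀, add_right_comm]
  rw [hr, coeff_succ_layer hroot W t hq0 hq0' hμj, hpow, X_pow_eq_monomial, C_mul_monomial, mul_one,
    coeff_mul_monomial']

/-- **THE CUBIC WITNESS**: `coeff_{r_{t+1} + 3e_k} F_{t+1} ≠ 0`. [new] [folklore] -/
theorem cubic_witness (hroot : IsRoot q s₀) (h : TightRepeat W t k) :
    coeff ((W.st (t + 1)).r + Finsupp.single k 3) (W.st (t + 1)).F ≠ 0 := by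
  classical
  obtain ⟨o₀, o₁, o₂, ho₀, ho₁, -, -⟩ := h.orders hroot
  obtain ⟨c, hc, hface⟩ := h.coeff_face hroot ho₀ ho₁
  rw [hface _ (Finsupp.single_eq_of_ne h.kj.symm), if_pos le_rfl, tsub_self, coeff_zero_bPoly]
  exact mul_ne_zero (bUnit_ne_zero W t) hc

/-- **PLATEAU AT `t+2` ⇒ the face `(·, 1, 0)` of `F_{t+1}` starts at `u_i`-exponent `r_{t+1}(i) + 4`.**  A monomial
`u^{r_{t+1} + a e_i + e_j}` of `F_{t+1}` is carried by the untranslated move `t+1` to a monomial of `F_{t+2}` of degree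
`o_{t+1} − 3 + a`, which must be `≥ o_{t+2} = o_{t+1} + 1`. [new] [folklore] -/
theorem four_le (hroot : IsRoot q s₀) (h : TightRepeat W t k) (a : ℕ)
    (ha : coeff ((W.st (t + 1)).r + Finsupp.single (W.j (t + 1)) a + Finsupp.single (W.j t) 1)
      (W.st (t + 1)).F ≠ 0) : 4 ≤ a := by
  classical
  obtain ⟨o₀, o₁, o₂, ho₀, ho₁, ho₂, hq0, -, hq1, -, hq2, -, -, -, -⟩ := h.orders hroot
  obtain ⟨hl0, hl1, hl2, hl3, hl4, hl5, hl6, hl7⟩ := h.ledger hroot ho₀ ho₁ ho₂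
  set m := (W.st (t + 1)).r + Finsupp.single (W.j (t + 1)) a + Finsupp.single (W.j t) 1 with hm
  have hmem : m ∈ (W.st (t + 1)).F.support := mem_support_iff.mpr ha
  have hmj : m (W.j t) = (W.st (t + 1)).r (W.j t) + 1 := by
    rw [hm, Finsupp.add_apply, Finsupp.add_apply, Finsupp.single_eq_of_ne h.ne.symm, Finsupp.single_eq_same,
      add_zero]
  have hmi : m (W.j (t + 1)) = (W.st (t + 1)).r (W.j (t + 1)) + a := by
    rw [hm, Finsupp.add_apply, Finsupp.add_apply, Finsupp.single_eq_same, Finsupp.single_eq_of_ne h.ne, add_zero]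
  have hmdeg : m.degree = (W.st (t + 1)).r.degree + a + 1 := by
    rw [hm, map_add, map_add, Finsupp.degree_single, Finsupp.degree_single]
  have ht := h.tight
  have hP : ¬ IsPthPowerExponent q (chartExponent q (W.j (t + 1)) m) :=
    not_isPthPowerExponent_of_coord (W.j t) (by rw [chartExponent_apply_ne q h.ne.symm, hmj]; omega)
      (by rw [chartExponent_apply_ne q h.ne.symm, hmj]; omega)
  have hc : coeff (chartExponent q (W.j (t + 1)) m) (W.st (t + 2)).F ≠ 0 := by
    rw [coeff_succ_of_untranslated hroot W (t + 1) h.untrans hmem hP]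
    exact ha
  have hdeg := le_degree_of_coeff_ne_zero ho₂ hc
  have hce := degree_chartExponent_add q (W.j (t + 1)) (m := m) (le_degree_of_mem_support hroot W (t + 1) hmem)
  omega

/-- **THE QUARTIC WITNESS (PROVED)**: `coeff_{r_{t+1} + 4e_i + e_j} F_{t+1} ≠ 0`.  The AXIS LAW at `t+1` (pair
`(j_t, k)`) gives a monomial `u^{r_{t+1} + μ}` with `μ_j + μ_k ≤ 1`; the cubic face excludes `μ_j = 0`; so the face
`(·, 1, 0)` is non-empty.  By the face identity at the layer `o_t + 1` this face is the `u_i`-slice of the Cauchy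
product `U_t · N_t(o_t + 1)` with `U_t(0) ≠ 0`, `deg N_t(o_t + 1) ≤ 4`: its MINIMAL index carries a non-zero
coefficient, is `≥ 4` (`four_le`) and `≤ 4`. [new] [folklore] -/
theorem quartic_witness (hroot : IsRoot q s₀) (h : TightRepeat W t k) :
    coeff ((W.st (t + 1)).r + Finsupp.single (W.j (t + 1)) 4 + Finsupp.single (W.j t) 1) (W.st (t + 1)).F ≠ 0 := by
  classical
  obtain ⟨o₀, o₁, o₂, ho₀, ho₁, ho₂, hq0, h02, hq1, -, hq2, -, hd0, -, -⟩ := h.orders hroot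
  obtain ⟨hl0, hl1, hl2, hl3, hl4, hl5, hl6, hl7⟩ := h.ledger hroot ho₀ ho₁ ho₂
  have ht := h.tight
  have hq01 : q < o₀ + 1 := by omega
  have h012 : o₀ + 1 < 2 * q := by omega
  -- the face `(·, 1, 0)` is the `u_i`-slice of `U_t · N_t(o_t + 1)`
  have hσ : ∀ a : ℕ, coeff ((W.st (t + 1)).r + Finsupp.single (W.j (t + 1)) a + Finsupp.single (W.j t) 1)
      (W.st (t + 1)).F = coeff (Finsupp.single (W.j (t + 1)) a) (bPoly W t * resForm W t (o₀ + 1)) := by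
    intro a
    have hr : (W.st (t + 1)).r + Finsupp.single (W.j (t + 1)) a + Finsupp.single (W.j t) 1 =
        kept W t + Finsupp.single (W.j (t + 1)) a + Finsupp.single (W.j t) (o₀ + 1 - q) := by
      rw [r_succ_eq W t ho₀, show o₀ + 1 - q = (o₀ - q) + 1 by omega, Finsupp.single_add]
      abel
    rw [hr]
    exact coeff_succ_layer hroot W t hq01 h012 (Finsupp.single_eq_of_ne h.ne.symm)
  -- a witness on the face: the AXIS LAW at `t+1` for the pair `(j_t, k)`, face `μ_j = 0` excluded by the cubic face
  obtain ⟨c, hc, hface⟩ := h.coeff_face hroot ho₀ ho₁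
  obtain ⟨m, hm, hlt⟩ := exists_support_pair_lt_of_isolatedTop (W.isolated (t + 1)) (W.j t) k h.kj.symm
  have hrm : (W.st (t + 1)).r ≤ m := walk_r hroot W (t + 1) m hm
  set μ := m - (W.st (t + 1)).r with hμ
  have hmμ : m = (W.st (t + 1)).r + μ := by rw [hμ, add_tsub_cancel_of_le hrm]
  have hμjk : μ (W.j t) = 1 ∧ μ k = 0 := by
    have h1 : μ (W.j t) + μ k ≤ 1 := by
      have a1 := Finsupp.le_def.mp hrm (W.j t)
      have a2 := Finsupp.le_def.mp hrm k
      rw [hμ, Finsupp.tsub_apply, Finsupp.tsub_apply]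
      omega
    by_contra hcon
    have hμj0 : μ (W.j t) = 0 := by omega
    have hcoef : coeff ((W.st (t + 1)).r + μ) (W.st (t + 1)).F ≠ 0 := by
      rw [← hmμ]; exact mem_support_iff.mp hm
    rw [hface μ hμj0] at hcoef
    split_ifs at hcoef with hle
    · have a3 := Finsupp.le_def.mp hle k
      rw [Finsupp.single_eq_same] at a3
      omega
    · exact hcoef rfl
  have hμeq : μ = Finsupp.single (W.j (t + 1)) (μ (W.j (t + 1))) + Finsupp.single (W.j t) 1 := by
    ext l
    rcases fin3_cases h.ne h.ki h.kj l with hl | hl | hl <;> rw [hl, Finsupp.add_apply]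
    · rw [Finsupp.single_eq_same, Finsupp.single_eq_of_ne h.ne, add_zero]
    · rw [Finsupp.single_eq_of_ne h.ne.symm, Finsupp.single_eq_same, zero_add]
      exact hμjk.1
    · rw [Finsupp.single_eq_of_ne h.ki, Finsupp.single_eq_of_ne h.kj, add_zero]
      exact hμjk.2
  -- the slice `P(y) = coeff_{y e_i} N_t(o_t+1)` is not identically zero
  set T := resForm W t (o₀ + 1) with hT
  have hex : ∃ y : ℕ, coeff (Finsupp.single (W.j (t + 1)) y) T ≠ 0 := by
    have h0 : coeff ((W.st (t + 1)).r + μ) (W.st (t + 1)).F ≠ 0 := by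
      rw [← hmμ]; exact mem_support_iff.mp hm
    rw [hμeq, ← add_assoc, hσ, coeff_mul] at h0
    obtain ⟨x, hx, hne⟩ := Finset.exists_ne_zero_of_sum_ne_zero h0
    have hsum : x.1 + x.2 = Finsupp.single (W.j (t + 1)) (μ (W.j (t + 1))) :=
      Finset.HasAntidiagonal.mem_antidiagonal.mp hx
    have hy : x.2 ≤ Finsupp.single (W.j (t + 1)) (μ (W.j (t + 1))) := by rw [← hsum]; exact le_add_self
    refine ⟨x.2 (W.j (t + 1)), ?_⟩
    rw [← eq_single_of_le_single hy]
    exact right_ne_zero_of_mul hne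
  -- its MINIMAL index `y₀` carries `coeff = U_t(0) · P(y₀) ≠ 0` on the face
  have hy₀ : coeff (Finsupp.single (W.j (t + 1)) (Nat.find hex)) T ≠ 0 := Nat.find_spec hex
  have hmin : ∀ y, y < Nat.find hex → coeff (Finsupp.single (W.j (t + 1)) y) T = 0 := fun y hy => by
    by_contra hne
    exact Nat.find_min hex hy hne
  have hσy : coeff ((W.st (t + 1)).r + Finsupp.single (W.j (t + 1)) (Nat.find hex) + Finsupp.single (W.j t) 1)
      (W.st (t + 1)).F ≠ 0 := by
    rw [hσ, coeff_mul, Finset.sum_eq_single ((0 : Fin 3 →₀ ℕ), Finsupp.single (W.j (t + 1)) (Nat.find hex))]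
    · rw [coeff_zero_bPoly]
      exact mul_ne_zero (bUnit_ne_zero W t) hy₀
    · intro x hx hne
      have hsum : x.1 + x.2 = Finsupp.single (W.j (t + 1)) (Nat.find hex) :=
        Finset.HasAntidiagonal.mem_antidiagonal.mp hx
      have hy : x.2 ≤ Finsupp.single (W.j (t + 1)) (Nat.find hex) := by rw [← hsum]; exact le_add_self
      have hx2 := eq_single_of_le_single hy
      by_cases hlt : x.2 (W.j (t + 1)) < Nat.find hex
      · rw [hx2, hmin _ hlt, mul_zero]
      · exfalso
        have hle : x.2 (W.j (t + 1)) ≤ Nat.find hex := by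
          have a1 := Finsupp.le_def.mp hy (W.j (t + 1))
          rwa [Finsupp.single_eq_same] at a1
        have heq : x.2 (W.j (t + 1)) = Nat.find hex := by omega
        rw [heq] at hx2
        have hx1 : x.1 = 0 := by
          rw [hx2] at hsum
          exact add_right_cancel (hsum.trans (zero_add _).symm)
        exact hne (Prod.ext hx1 hx2)
    · intro hnot
      exact absurd (Finset.HasAntidiagonal.mem_antidiagonal.mpr (zero_add _)) hnot
  -- hence `4 ≤ y₀ ≤ 4`
  have h4 : 4 ≤ Nat.find hex := h.four_le hroot _ hσy
  have hdeg : (Finsupp.single (W.j (t + 1)) (Nat.find hex)).degree ≤ o₀ + 1 - (W.st t).r.degree :=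
    degree_le_of_coeff_translate_resLayer_ne_zero (W.j t) (W.b t) (W.st t) (walk_r hroot W t) (o₀ + 1) hy₀
  rw [Finsupp.degree_single] at hdeg
  have hy4 : Nat.find hex = 4 := by omega
  rw [hy4] at hσy
  exact hσy

/-! ### §J₂.5 Transport to `F_{t+2}`: the cubic face of `F_{t+2}` and the two witnesses there -/

/-- The chart image of `u^{r_{t+1}} u_k^3` is `u^{r_{t+2}} u_k^3`. [folklore] -/
theorem chartExponent_cubic (hroot : IsRoot q s₀) (h : TightRepeat W t k) :
    chartExponent q (W.j (t + 1)) ((W.st (t + 1)).r + Finsupp.single k 3) =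
      (W.st (t + 2)).r + Finsupp.single k 3 := by
  obtain ⟨o₀, o₁, o₂, ho₀, ho₁, ho₂, -⟩ := h.orders hroot
  obtain ⟨hl0, hl1, hl2, hl3, hl4, hl5, hl6, hl7⟩ := h.ledger hroot ho₀ ho₁ ho₂
  ext l
  rcases fin3_cases h.ne h.ki h.kj l with hl | hl | hl <;> rw [hl]
  · rw [chartExponent_self, map_add, Finsupp.degree_single, Finsupp.add_apply,
      Finsupp.single_eq_of_ne h.ki.symm, add_zero]
    omega
  · rw [chartExponent_apply_ne q h.ne.symm, Finsupp.add_apply, Finsupp.add_apply, hl2]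
  · rw [chartExponent_apply_ne q h.ki, Finsupp.add_apply, Finsupp.add_apply, hl3]

/-- The chart image of `u^{r_{t+1}} u_i^4 u_j` is `u^{r_{t+2}} u_i^2 u_j`. [folklore] -/
theorem chartExponent_quartic (hroot : IsRoot q s₀) (h : TightRepeat W t k) :
    chartExponent q (W.j (t + 1)) ((W.st (t + 1)).r + Finsupp.single (W.j (t + 1)) 4 + Finsupp.single (W.j t) 1) =
      (W.st (t + 2)).r + Finsupp.single (W.j (t + 1)) 2 + Finsupp.single (W.j t) 1 := by
  obtain ⟨o₀, o₁, o₂, ho₀, ho₁, ho₂, -⟩ := h.orders hroot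
  obtain ⟨hl0, hl1, hl2, hl3, hl4, hl5, hl6, hl7⟩ := h.ledger hroot ho₀ ho₁ ho₂
  ext l
  rcases fin3_cases h.ne h.ki h.kj l with hl | hl | hl <;> rw [hl]
  · rw [chartExponent_self, map_add, map_add, Finsupp.degree_single, Finsupp.degree_single, Finsupp.add_apply,
      Finsupp.add_apply, Finsupp.single_eq_same, Finsupp.single_eq_of_ne h.ne, add_zero]
    omega
  · rw [chartExponent_apply_ne q h.ne.symm, Finsupp.add_apply, Finsupp.add_apply, Finsupp.add_apply,
      Finsupp.add_apply, Finsupp.single_eq_of_ne h.ne.symm, Finsupp.single_eq_of_ne h.ne.symm, hl2]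
  · rw [chartExponent_apply_ne q h.ki, Finsupp.add_apply, Finsupp.add_apply, Finsupp.add_apply, Finsupp.add_apply,
      Finsupp.single_eq_of_ne h.ki, Finsupp.single_eq_of_ne h.ki, Finsupp.single_eq_of_ne h.kj, hl3]

/-- **THE CUBIC WITNESS OF `F_{t+2}`**: `coeff_{r_{t+2} + 3e_k} F_{t+2} ≠ 0`. [new] [folklore] -/
theorem cubic_witness₂ (hroot : IsRoot q s₀) (h : TightRepeat W t k) :
    coeff ((W.st (t + 2)).r + Finsupp.single k 3) (W.st (t + 2)).F ≠ 0 := by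
  classical
  obtain ⟨o₀, o₁, o₂, ho₀, ho₁, ho₂, hq0, -⟩ := h.orders hroot
  obtain ⟨hl0, hl1, hl2, hl3, hl4, hl5, hl6, hl7⟩ := h.ledger hroot ho₀ ho₁ ho₂
  have ht := h.tight
  have hmem := mem_support_iff.mpr (h.cubic_witness hroot)
  have hP : ¬ IsPthPowerExponent q (chartExponent q (W.j (t + 1)) ((W.st (t + 1)).r + Finsupp.single k 3)) := by
    rw [h.chartExponent_cubic hroot]
    exact not_isPthPowerExponent_of_coord (W.j t)
      (by rw [Finsupp.add_apply, Finsupp.single_eq_of_ne h.kj.symm, hl2]; omega)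
      (by rw [Finsupp.add_apply, Finsupp.single_eq_of_ne h.kj.symm, hl2]; omega)
  rw [← h.chartExponent_cubic hroot, coeff_succ_of_untranslated hroot W (t + 1) h.untrans hmem hP]
  exact h.cubic_witness hroot

/-- **THE QUADRATIC-LINEAR WITNESS OF `F_{t+2}`**: `coeff_{r_{t+2} + 2e_i + e_j} F_{t+2} ≠ 0`. [new] [folklore] -/
theorem quartic_witness₂ (hroot : IsRoot q s₀) (h : TightRepeat W t k) :
    coeff ((W.st (t + 2)).r + Finsupp.single (W.j (t + 1)) 2 + Finsupp.single (W.j t) 1) (W.st (t + 2)).F ≠ 0 := by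
  classical
  obtain ⟨o₀, o₁, o₂, ho₀, ho₁, ho₂, hq0, -⟩ := h.orders hroot
  obtain ⟨hl0, hl1, hl2, hl3, hl4, hl5, hl6, hl7⟩ := h.ledger hroot ho₀ ho₁ ho₂
  have ht := h.tight
  have hmem := mem_support_iff.mpr (h.quartic_witness hroot)
  have hP : ¬ IsPthPowerExponent q (chartExponent q (W.j (t + 1))
      ((W.st (t + 1)).r + Finsupp.single (W.j (t + 1)) 4 + Finsupp.single (W.j t) 1)) := by
    rw [h.chartExponent_quartic hroot]
    exact not_isPthPowerExponent_of_coord (W.j t)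
      (by rw [Finsupp.add_apply, Finsupp.add_apply, Finsupp.single_eq_of_ne h.ne.symm, Finsupp.single_eq_same,
            hl2]; omega)
      (by rw [Finsupp.add_apply, Finsupp.add_apply, Finsupp.single_eq_of_ne h.ne.symm, Finsupp.single_eq_same,
            hl2]; omega)
  rw [← h.chartExponent_quartic hroot, coeff_succ_of_untranslated hroot W (t + 1) h.untrans hmem hP]
  exact h.quartic_witness hroot

/-- **THE CUBIC FACE OF `F_{t+2}` (PROVED)**: a monomial of the initial (degree-`o_{t+2}`) layer of `F_{t+2}` on the
face `M_{j_t} = r_{t+2}(j_t)` IS `u^{r_{t+2}} u_k^3`. [new] [folklore] -/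
theorem face₂ (hroot : IsRoot q s₀) (h : TightRepeat W t k) {o₂ : ℕ} (ho₂ : ordZero (W.st (t + 2)).F = o₂)
    {M : Fin 3 →₀ ℕ} (hM : M ∈ (W.st (t + 2)).F.support) (hdeg : M.degree = o₂)
    (hMj : M (W.j t) = (W.st (t + 2)).r (W.j t)) : M = (W.st (t + 2)).r + Finsupp.single k 3 := by
  classical
  obtain ⟨o₀, o₁, p₂, ho₀, ho₁, hp₂, hq0, -, hq1, -, -, -, -, -, -⟩ := h.orders hroot
  have e2 : p₂ = o₂ := by have := hp₂.symm.trans ho₂; exact_mod_cast this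
  subst e2
  obtain ⟨hl0, hl1, hl2, hl3, hl4, hl5, hl6, hl7⟩ := h.ledger hroot ho₀ ho₁ ho₂
  obtain ⟨c, hc, hface⟩ := h.coeff_face hroot ho₀ ho₁
  obtain ⟨m, hm, hcE, -⟩ := exists_preimage_of_untranslated hroot W (t + 1) h.untrans hM
  have hrm : (W.st (t + 1)).r ≤ m := walk_r hroot W (t + 1) m hm
  set μ := m - (W.st (t + 1)).r with hμ
  have hmμ : m = (W.st (t + 1)).r + μ := by rw [hμ, add_tsub_cancel_of_le hrm]
  have hμj : μ (W.j t) = 0 := by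
    have h1 : m (W.j t) = M (W.j t) := by rw [← hcE, chartExponent_apply_ne q h.ne.symm]
    rw [hμ, Finsupp.tsub_apply, h1, hMj, hl2]
    omega
  have hcm : coeff ((W.st (t + 1)).r + μ) (W.st (t + 1)).F ≠ 0 := by
    rw [← hmμ]; exact mem_support_iff.mp hm
  rw [hface μ hμj] at hcm
  split_ifs at hcm with hle
  swap
  · exact absurd rfl hcm
  set E := μ - Finsupp.single k 3 with hE
  have hμE : μ = E + Finsupp.single k 3 := by rw [hE, tsub_add_cancel_of_le hle]
  have hce := degree_chartExponent_add q (W.j (t + 1)) (m := m) (le_degree_of_mem_support hroot W (t + 1) hm)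
  rw [hcE, hdeg] at hce
  have hmdeg : m.degree = (W.st (t + 1)).r.degree + E.degree + 3 := by
    rw [hmμ, hμE, map_add, map_add, Finsupp.degree_single, add_assoc]
  have hmi : m (W.j (t + 1)) = (W.st (t + 1)).r (W.j (t + 1)) + E (W.j (t + 1)) := by
    rw [hmμ, hμE, Finsupp.add_apply, Finsupp.add_apply, Finsupp.single_eq_of_ne h.ki.symm, add_zero]
  have hEdeg := degree_eq_three E h.ne h.ki h.kj
  have hE0 : E = 0 := (Finsupp.degree_eq_zero_iff _).mp (by omega)
  rw [← hcE, hmμ, hμE, hE0, zero_add]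
  exact h.chartExponent_cubic hroot

end TightRepeat

end LawJ2Witness

end Summit.ResolutionOfSingularities.ResolutionOfSingularities.Theorems.TightCut
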